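import Literature.MathematicalPhysics.QuantumFieldTheory.Balaban1983to89.B9Thm311CubeLettersGCoerciveGauge

/-!
# `Balaban1983to89.B9Thm311CubeLettersGCoerciveDiag` — [B9] (3.84)–(3.86) p. 407 ∕ Thm 3.11 p. 416 FOR THE CUBE LETTERS IN `L²`, THE DIAGONAL-FORM ENGINE:
# `⟨C, V C⟩ ≦ a⟨C,C⟩ + b‖C‖⟨C,T₀C⟩^{1/2} + e⟨C,T₀C⟩` (one-sided) ⟹ `(1 − a∕m − b∕√m − e)⟨C,T₀C⟩ ≦ ⟨C,(T₀ − V)C⟩` — the hypothesis shape the Laplacian piece of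
# `V(A)` actually yields term by term (adjointness puts one derivative on each side), read at r05's cube letters and transported along the (3.35) gauge

statement-level skeleton of published theorems with citation tags; proofs where landed; nothing here is a claim about the Yang–Mills mass gap

T. Bałaban, *Propagators for lattice gauge theories in a background field*, Commun. Math. Phys. **99** (1985) 389–434 [`Balaban1985BackgroundPropagators`,
"[B9]"; held text `paper:balaban1985-cmp99-background-propagators`, journal page = PDF page + 388; pp. 392, 404–407, 416 read first-hand].

THE PRINT (verbatim).  p. 404 (3.70)–(3.73): «Δ(U′U) = D*_{U′U}D_{U′U} + Δ′(U′U) … It is easy to see that for the difference Δ′(U′U) − Δ′(U) we have a bound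
similar to (3.69) … Thus we have to investigate only an expansion of the operator D*_{U′U}D_{U′U} … = (D*DA′)(x) − … (V₁(A)A′)(x)»; p. 407: «The operator
V₃(A) is a local differential operator of the first order satisfying the bound (3.73)»; (3.84): «Δ_a(U′U) = Δ_a(U) − V(A)»; p. 416: «by the same reasoning as
above we prove positivity of G_□».  p. 392 (3.9)–(3.10): `Δ(U) = D*_U𝒦_UD_U + Δ′₂(U)` (co-curl adjoint to curl).

WHY THIS FILE.  `B9Thm311CubeLettersGCoercive` (✓ p620365) asks input (ii) in the OFF-DIAGONAL shape `|⟨B, VC⟩| ≦ ‖B‖(a‖C‖ + b‖C‖_E)`.  For the coercivity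
road (its ★★ `coercive_sub_of_relBound`) only the DIAGONAL `⟨C, VC⟩` is ever evaluated, and the Laplacian piece `Δ(U₀) − Δ(U′) = D*₀𝒦₀D₀ − D*′𝒦′D′ +
(Δ′₂(U₀) − Δ′₂(U′))` (def-Y `hessY = coCurlY ∘ jordanY ∘ curlY + curv2Y`) delivers its diagonal bound term by term in the richer shape `a⟨C,C⟩ +
b‖C‖·‖D₀C‖ + e‖D₀C‖²` — the co-curl difference against `D₀C` (b), the Jordan factor `1 − 𝒦′` between two curls (e), the curl difference against `𝒦′D′C`
by adjointness (b + a), `Δ′₂` (a) — with the ENERGY DOMINATION `‖D₀C‖² = ⟨C, Δ(U₀)C⟩ ≦ ⟨C, Δ_{a,□}(U₀)C⟩` at a flat `U₀` (n06-j `trIP_hessY_eq_curl_of_flat`, r05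
★ `trIP_hessY_le_trIP_deltaACubeY`).  THIS FILE proves the diagonal-form engine (§1), reads it at r05's cube letters with the gauge transport of
`B9Thm311CubeLettersGCoerciveGauge` (§2), and records the energy domination in the form the piece bounds use (§3).  The piece bounds themselves
(window sizes of `U′ − 1` and of the plaquette holonomies) are NOT proved here.

WHAT IS PROVED (sorry-free; 0 `def`).
* §1 (any finite carrier, weight `w > 0`): `diagBound_of_relBound` (p620365's off-diagonal shape is the case `e = 0`), `diag_le_energy`, `upper_of_diagBound`,
  ★★ `trIP_sub_apply_self_ge_of_upperDiagBound` (needs only the ONE-SIDED bound `⟨C,RC⟩ ≦ …`), `trIP_sub_apply_self_le_of_diagBound` (two-sided), ★★ `coercive_sub_of_upperDiagBound`,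
  `posDefTr_sub_of_upperDiagBound`, `isUnit_sub_of_upperDiagBound`, `trIP_inverse_sub_le_of_upperDiagBound`.
* §2 at r05's cube letters (ONE-SIDED bounds suffice): ★★★ `deltaACubeY_coercive_of_upperDiagBound` (any transporters, any `U₀`, `U′`),
  ★★★ `deltaACubeY_posDefTr_of_upperDiagBound`, ★★★ `GACubeY_parSymY_bounds_of_upperDiagBoundGauge` (at the ORIGINAL `U` through a `G`-valued gauge, `G ≦ U(N)`).
* §3 `trIP_curlY_one_self_le_energy` — `‖D₁C‖² ≦ ⟨C, Δ_{a,□}(1)C⟩` at def-Y's v4 transporters (BY NAME from n06-j + r05).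

HONEST SCOPE.  Form algebra; the diagonal bound (a, b, e) is a displayed hypothesis; `L²` only; count-neutral; NOT a node discharge; no summit ∕ sub-problem
claim (rungs R3∕R4 conditional; nothing continuum ∕ OS ∕ mass gap; not Clay).  No `sorry`∕`axiom`∕`instance`∕`notation`; NEW file.  Seat `ym-inputs-p02`, 2026-08-28.
-/

namespace Literature.MathematicalPhysics.QuantumFieldTheory.Balaban1983to89.B9Thm311CubeLettersGCoerciveDiag

open B9Thm311ReadingCoords B9Thm311DeltaPrimePos B9Thm31SiteGpBoundsReg335Y Node00 B9CubeLettersBondOpsL0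
  B9CubeLettersBondOpsAtOneIdentL0 B9CubeLettersCovarianceL0 B9Thm311DeltaAGaugeOrbit B9Thm311CubeLettersG B9Thm311CubeLettersGCoercive
  B9Thm311CubeLettersGCoerciveGauge B9Thm311AdjointAtLetters B9Thm311CubeLettersFirstThree B9Thm311CoercivePureGaugeAtLettersY
open Literature.MathematicalPhysics.QuantumFieldTheory.Balaban1983to89.B6KLevelCensusIndexV1 (KIdx)
open Literature.MathematicalPhysics.QuantumFieldTheory.Balaban1983to89.B6Cover236MultiLevelBlocks (cubes)
open Literature.MathematicalPhysics.QuantumFieldTheory.Balaban1983to89.B9Eq3132CoerciveVariational (trIP_sub_right)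
open scoped Matrix

noncomputable section

/-! ## §1 The diagonal-form engine -/

section Engine

variable {S : Type} [Fintype S] {N : ℕ} {w : S → ℝ}
  {T₀ R : (S → Matrix (Fin N) (Fin N) ℂ) →ₗ[ℂ] (S → Matrix (Fin N) (Fin N) ℂ)} {m a b e : ℝ}

/-- p620365's off-diagonal relative bound implies the diagonal bound with `e = 0`. [cite: Balaban1985BackgroundPropagators, (3.84)–(3.85) p.407; bookkeeping] -/
theorem diagBound_of_relBound
    (hrel : ∀ Φ Ψ, |trIP w Φ (R Ψ)| ≤ Real.sqrt (trIP w Φ Φ) * (a * Real.sqrt (trIP w Ψ Ψ) + b * Real.sqrt (trIP w Ψ (T₀ Ψ))))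
    (hw : ∀ s, 0 < w s) (Φ : S → Matrix (Fin N) (Fin N) ℂ) :
    |trIP w Φ (R Φ)| ≤ a * trIP w Φ Φ + b * Real.sqrt (trIP w Φ Φ) * Real.sqrt (trIP w Φ (T₀ Φ)) + 0 * trIP w Φ (T₀ Φ) := by
  have h := hrel Φ Φ
  have h1 : Real.sqrt (trIP w Φ Φ) * Real.sqrt (trIP w Φ Φ) = trIP w Φ Φ := Real.mul_self_sqrt (trIP_self_nonneg w hw Φ)
  have h2 : Real.sqrt (trIP w Φ Φ) * (a * Real.sqrt (trIP w Φ Φ) + b * Real.sqrt (trIP w Φ (T₀ Φ))) =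
      a * (Real.sqrt (trIP w Φ Φ) * Real.sqrt (trIP w Φ Φ)) + b * Real.sqrt (trIP w Φ Φ) * Real.sqrt (trIP w Φ (T₀ Φ)) := by ring
  rw [h1] at h2
  rw [h2] at h
  linarith

/-- ★ the scale bookkeeping in diagonal form: `a⟨C,C⟩ + b‖C‖‖C‖_E + e‖C‖_E² ≦ (a∕m + b∕√m + e)·⟨C, T₀C⟩` under `m⟨C,C⟩ ≦ ⟨C,T₀C⟩`.
[cite: Balaban1985BackgroundPropagators, (3.73) p.404, (3.85) p.407; folklore] -/
theorem diag_le_energy (hw : ∀ s, 0 < w s) (hm : 0 < m) (ha : 0 ≤ a) (hb : 0 ≤ b)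
    (hco : ∀ Φ, m * trIP w Φ Φ ≤ trIP w Φ (T₀ Φ)) (Ψ : S → Matrix (Fin N) (Fin N) ℂ) :
    a * trIP w Ψ Ψ + b * Real.sqrt (trIP w Ψ Ψ) * Real.sqrt (trIP w Ψ (T₀ Ψ)) + e * trIP w Ψ (T₀ Ψ) ≤
      (a / m + b / Real.sqrt m + e) * trIP w Ψ (T₀ Ψ) := by
  have h := sqrt_mul_relBound_le_energy hw hm ha hb hco Ψ
  have h1 : Real.sqrt (trIP w Ψ Ψ) * Real.sqrt (trIP w Ψ Ψ) = trIP w Ψ Ψ := Real.mul_self_sqrt (trIP_self_nonneg w hw Ψ)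
  have h2 : Real.sqrt (trIP w Ψ Ψ) * (a * Real.sqrt (trIP w Ψ Ψ) + b * Real.sqrt (trIP w Ψ (T₀ Ψ))) =
      a * (Real.sqrt (trIP w Ψ Ψ) * Real.sqrt (trIP w Ψ Ψ)) + b * Real.sqrt (trIP w Ψ Ψ) * Real.sqrt (trIP w Ψ (T₀ Ψ)) := by ring
  rw [h1] at h2
  rw [h2] at h
  have h3 : (a / m + b / Real.sqrt m + e) * trIP w Ψ (T₀ Ψ) = (a / m + b / Real.sqrt m) * trIP w Ψ (T₀ Ψ) + e * trIP w Ψ (T₀ Ψ) := by ring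
  rw [h3]
  linarith

/-- a two-sided diagonal bound gives the one-sided (upper) one the coercivity road consumes. [cite: Balaban1985BackgroundPropagators, (3.84) p.407; bookkeeping] -/
theorem upper_of_diagBound
    (hdiag : ∀ Φ, |trIP w Φ (R Φ)| ≤ a * trIP w Φ Φ + b * Real.sqrt (trIP w Φ Φ) * Real.sqrt (trIP w Φ (T₀ Φ)) + e * trIP w Φ (T₀ Φ))
    (Φ : S → Matrix (Fin N) (Fin N) ℂ) :
    trIP w Φ (R Φ) ≤ a * trIP w Φ Φ + b * Real.sqrt (trIP w Φ Φ) * Real.sqrt (trIP w Φ (T₀ Φ)) + e * trIP w Φ (T₀ Φ) :=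
  le_trans (le_abs_self _) (hdiag Φ)

/-- ★★ **LOWER COMPARISON FROM A ONE-SIDED (UPPER) DIAGONAL BOUND OF THE REMAINDER**: `⟨C, RC⟩ ≦ a⟨C,C⟩ + b‖C‖‖C‖_E + e‖C‖_E²` (no absolute value — the
Laplacian piece is bounded from ABOVE by n06-j's lower bound `trIP_hessY_ge` of the perturbed Hessian) gives `(1 − (a∕m + b∕√m + e))⟨C, T₀C⟩ ≦ ⟨C, (T₀ − R)C⟩`.
[cite: Balaban1985BackgroundPropagators, (3.84) p.407, Thm 3.11 p.416, p.392 (after (3.10))] -/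
theorem trIP_sub_apply_self_ge_of_upperDiagBound (hw : ∀ s, 0 < w s) (hm : 0 < m) (ha : 0 ≤ a) (hb : 0 ≤ b)
    (hco : ∀ Φ, m * trIP w Φ Φ ≤ trIP w Φ (T₀ Φ))
    (hup : ∀ Φ, trIP w Φ (R Φ) ≤ a * trIP w Φ Φ + b * Real.sqrt (trIP w Φ Φ) * Real.sqrt (trIP w Φ (T₀ Φ)) + e * trIP w Φ (T₀ Φ))
    (Φ : S → Matrix (Fin N) (Fin N) ℂ) :
    (1 - (a / m + b / Real.sqrt m + e)) * trIP w Φ (T₀ Φ) ≤ trIP w Φ ((T₀ - R) Φ) := by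
  have h := diag_le_energy (e := e) hw hm ha hb hco Φ
  have hR : trIP w Φ (R Φ) ≤ (a / m + b / Real.sqrt m + e) * trIP w Φ (T₀ Φ) := le_trans (hup Φ) h
  rw [LinearMap.sub_apply, trIP_sub_right]
  linarith

/-- ★★ **UPPER COMPARISON IN DIAGONAL FORM**: `⟨C, (T₀ − R)C⟩ ≦ (1 + (a∕m + b∕√m + e))⟨C, T₀C⟩`. [cite: Balaban1985BackgroundPropagators, (3.84) p.407, Thm 3.11 p.416] -/
theorem trIP_sub_apply_self_le_of_diagBound (hw : ∀ s, 0 < w s) (hm : 0 < m) (ha : 0 ≤ a) (hb : 0 ≤ b)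
    (hco : ∀ Φ, m * trIP w Φ Φ ≤ trIP w Φ (T₀ Φ))
    (hdiag : ∀ Φ, |trIP w Φ (R Φ)| ≤ a * trIP w Φ Φ + b * Real.sqrt (trIP w Φ Φ) * Real.sqrt (trIP w Φ (T₀ Φ)) + e * trIP w Φ (T₀ Φ))
    (Φ : S → Matrix (Fin N) (Fin N) ℂ) :
    trIP w Φ ((T₀ - R) Φ) ≤ (1 + (a / m + b / Real.sqrt m + e)) * trIP w Φ (T₀ Φ) := by
  have h := diag_le_energy (e := e) hw hm ha hb hco Φ
  have hR : -trIP w Φ (R Φ) ≤ (a / m + b / Real.sqrt m + e) * trIP w Φ (T₀ Φ) := le_trans (le_trans (neg_le_abs _) (hdiag Φ)) h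
  rw [LinearMap.sub_apply, trIP_sub_right]
  linarith

/-- ★★ **COERCIVITY IN DIAGONAL FORM**: `(1 − θ)m⟨C,C⟩ ≦ ⟨C,(T₀ − R)C⟩`, `θ = a∕m + b∕√m + e ≦ 1`. [cite: Balaban1985BackgroundPropagators, (3.84)–(3.86) p.407, Thm 3.11 p.416] -/
theorem coercive_sub_of_upperDiagBound (hw : ∀ s, 0 < w s) (hm : 0 < m) (ha : 0 ≤ a) (hb : 0 ≤ b)
    (hco : ∀ Φ, m * trIP w Φ Φ ≤ trIP w Φ (T₀ Φ))
    (hup : ∀ Φ, trIP w Φ (R Φ) ≤ a * trIP w Φ Φ + b * Real.sqrt (trIP w Φ Φ) * Real.sqrt (trIP w Φ (T₀ Φ)) + e * trIP w Φ (T₀ Φ))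
    (hθ : a / m + b / Real.sqrt m + e ≤ 1) (Φ : S → Matrix (Fin N) (Fin N) ℂ) :
    ((1 - (a / m + b / Real.sqrt m + e)) * m) * trIP w Φ Φ ≤ trIP w Φ ((T₀ - R) Φ) := by
  have h := trIP_sub_apply_self_ge_of_upperDiagBound hw hm ha hb hco hup Φ
  have h1 : 0 ≤ 1 - (a / m + b / Real.sqrt m + e) := by linarith
  calc ((1 - (a / m + b / Real.sqrt m + e)) * m) * trIP w Φ Φ = (1 - (a / m + b / Real.sqrt m + e)) * (m * trIP w Φ Φ) := by ring
    _ ≤ (1 - (a / m + b / Real.sqrt m + e)) * trIP w Φ (T₀ Φ) := mul_le_mul_of_nonneg_left (hco Φ) h1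
    _ ≤ _ := h

/-- positivity of the perturbed operator for `θ < 1`. [cite: Balaban1985BackgroundPropagators, Thm 3.11 p.416] -/
theorem posDefTr_sub_of_upperDiagBound (hw : ∀ s, 0 < w s) (hm : 0 < m) (ha : 0 ≤ a) (hb : 0 ≤ b)
    (hco : ∀ Φ, m * trIP w Φ Φ ≤ trIP w Φ (T₀ Φ))
    (hup : ∀ Φ, trIP w Φ (R Φ) ≤ a * trIP w Φ Φ + b * Real.sqrt (trIP w Φ Φ) * Real.sqrt (trIP w Φ (T₀ Φ)) + e * trIP w Φ (T₀ Φ))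
    (hθ : a / m + b / Real.sqrt m + e < 1) : PosDefTr w (T₀ - R) :=
  posDefTr_of_coercive hw (mul_pos (by linarith) hm) (coercive_sub_of_upperDiagBound hw hm ha hb hco hup hθ.le)

/-- invertibility of the perturbed operator for `θ < 1`. [cite: Balaban1985BackgroundPropagators, (3.86) p.407, (3.27) p.395] -/
theorem isUnit_sub_of_upperDiagBound (hw : ∀ s, 0 < w s) (hm : 0 < m) (ha : 0 ≤ a) (hb : 0 ≤ b)
    (hco : ∀ Φ, m * trIP w Φ Φ ≤ trIP w Φ (T₀ Φ))
    (hup : ∀ Φ, trIP w Φ (R Φ) ≤ a * trIP w Φ Φ + b * Real.sqrt (trIP w Φ Φ) * Real.sqrt (trIP w Φ (T₀ Φ)) + e * trIP w Φ (T₀ Φ))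
    (hθ : a / m + b / Real.sqrt m + e < 1) : IsUnit (T₀ - R) :=
  isUnit_of_coercive hw (mul_pos (by linarith) hm) (coercive_sub_of_upperDiagBound hw hm ha hb hco hup hθ.le)

/-- the inverse of the perturbed operator as a form: `(1 − θ)m⟨B, (T₀ − R)⁻¹B⟩ ≦ ⟨B, B⟩`. [cite: Balaban1985BackgroundPropagators, (3.86) p.407, Thm 3.3 p.399] -/
theorem trIP_inverse_sub_le_of_upperDiagBound (hw : ∀ s, 0 < w s) (hm : 0 < m) (ha : 0 ≤ a) (hb : 0 ≤ b)
    (hco : ∀ Φ, m * trIP w Φ Φ ≤ trIP w Φ (T₀ Φ))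
    (hup : ∀ Φ, trIP w Φ (R Φ) ≤ a * trIP w Φ Φ + b * Real.sqrt (trIP w Φ Φ) * Real.sqrt (trIP w Φ (T₀ Φ)) + e * trIP w Φ (T₀ Φ))
    (hθ : a / m + b / Real.sqrt m + e < 1) (Ψ : S → Matrix (Fin N) (Fin N) ℂ) :
    ((1 - (a / m + b / Real.sqrt m + e)) * m) * trIP w Ψ (Ring.inverse (T₀ - R) Ψ) ≤ trIP w Ψ Ψ :=
  trIP_ringInverse_le hw (mul_pos (by linarith) hm) (coercive_sub_of_upperDiagBound hw hm ha hb hco hup hθ.le) Ψ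

end Engine

/-! ## §2 At r05's cube letters, and along the (3.35) gauge -/

section CubeLetters

open scoped Matrix.Norms.L2Operator

variable {d ℓ : ℕ} {hd : 1 ≤ d + 1} {hL : Odd (ℓ + 1) ∧ 1 < ℓ + 1} {b₀ b₁ : ℝ} {N : ℕ}
variable (i : KIdx d ℓ hd hL b₀ b₁) (q : ↥(cubes (toKT i).D.toDomains)) {G : Subgroup (Matrix (Fin N) (Fin N) ℂ)ˣ}

/-- ★★★ **`Δ_{a,□}(U′)` IS COERCIVE FROM A DIAGONAL BOUND OF `V(A) = Δ_{a,□}(U₀) − Δ_{a,□}(U′)`**: `(1 − θ)m⟨C,C⟩ ≦ ⟨C, Δ_{a,□}(U′)C⟩`, `θ = a∕m + b∕√m + e ≦ 1`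
(any transporters, any two backgrounds). [cite: Balaban1985BackgroundPropagators, Thm 3.11 p.416, (3.84)–(3.86) p.407, p.409 l.3–5] -/
theorem deltaACubeY_coercive_of_upperDiagBound (parS : SiteParY (Matrix (Fin N) (Fin N) ℂ) i) (parB : BondParY (Matrix (Fin N) (Fin N) ℂ) i)
    (U₀ U' : CfgY (Matrix (Fin N) (Fin N) ℂ) i) {m a b e : ℝ} (hm : 0 < m) (ha : 0 ≤ a) (hb : 0 ≤ b)
    (hco : ∀ C, m * trIP (fun _ => (1 : ℝ)) C C ≤ trIP (fun _ => (1 : ℝ)) C (deltaACubeY i q parS parB U₀ C))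
    (hup : ∀ C, trIP (fun _ => (1 : ℝ)) C ((deltaACubeY i q parS parB U₀ - deltaACubeY i q parS parB U') C) ≤
      a * trIP (fun _ => (1 : ℝ)) C C +
        b * Real.sqrt (trIP (fun _ => (1 : ℝ)) C C) * Real.sqrt (trIP (fun _ => (1 : ℝ)) C (deltaACubeY i q parS parB U₀ C)) +
        e * trIP (fun _ => (1 : ℝ)) C (deltaACubeY i q parS parB U₀ C))
    (hθ : a / m + b / Real.sqrt m + e ≤ 1) (C : FBondY i → Matrix (Fin N) (Fin N) ℂ) :
    ((1 - (a / m + b / Real.sqrt m + e)) * m) * trIP (fun _ => (1 : ℝ)) C C ≤ trIP (fun _ => (1 : ℝ)) C (deltaACubeY i q parS parB U' C) := by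
  have h := coercive_sub_of_upperDiagBound (fun _ => one_pos) hm ha hb hco hup hθ C
  rwa [deltaACubeY_eq_sub_V] at h

/-- ★★★ **THEOREM 3.11 FOR THE CUBE LETTERS FROM (i) + A DIAGONAL BOUND**, `θ < 1`: `Δ_{a,□}(U′) > 0`, `IsUnit`, `G_□(U′) > 0`, `(1 − θ)m⟨B, G_□(U′)B⟩ ≦ ⟨B,B⟩`,
`((1 − θ)m)²‖G_□(U′)B‖² ≦ ‖B‖²`. [cite: Balaban1985BackgroundPropagators, Thm 3.11 p.416, (3.86) p.407, (3.27) p.395] -/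
theorem deltaACubeY_posDefTr_of_upperDiagBound (parS : SiteParY (Matrix (Fin N) (Fin N) ℂ) i) (parB : BondParY (Matrix (Fin N) (Fin N) ℂ) i)
    (U₀ U' : CfgY (Matrix (Fin N) (Fin N) ℂ) i) {m a b e : ℝ} (hm : 0 < m) (ha : 0 ≤ a) (hb : 0 ≤ b)
    (hco : ∀ C, m * trIP (fun _ => (1 : ℝ)) C C ≤ trIP (fun _ => (1 : ℝ)) C (deltaACubeY i q parS parB U₀ C))
    (hup : ∀ C, trIP (fun _ => (1 : ℝ)) C ((deltaACubeY i q parS parB U₀ - deltaACubeY i q parS parB U') C) ≤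
      a * trIP (fun _ => (1 : ℝ)) C C +
        b * Real.sqrt (trIP (fun _ => (1 : ℝ)) C C) * Real.sqrt (trIP (fun _ => (1 : ℝ)) C (deltaACubeY i q parS parB U₀ C)) +
        e * trIP (fun _ => (1 : ℝ)) C (deltaACubeY i q parS parB U₀ C))
    (hθ : a / m + b / Real.sqrt m + e < 1) :
    PosDefTr (fun _ => (1 : ℝ)) (deltaACubeY i q parS parB U') ∧ IsUnit (deltaACubeY i q parS parB U') ∧
      PosDefTr (fun _ => (1 : ℝ)) (GACubeY i q parS parB U') ∧
      (∀ B : FBondY i → Matrix (Fin N) (Fin N) ℂ,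
        ((1 - (a / m + b / Real.sqrt m + e)) * m) * trIP (fun _ => (1 : ℝ)) B (GACubeY i q parS parB U' B) ≤ trIP (fun _ => (1 : ℝ)) B B) ∧
      (∀ B : FBondY i → Matrix (Fin N) (Fin N) ℂ,
        ((1 - (a / m + b / Real.sqrt m + e)) * m) ^ 2 * trIP (fun _ => (1 : ℝ)) (GACubeY i q parS parB U' B) (GACubeY i q parS parB U' B) ≤
          trIP (fun _ => (1 : ℝ)) B B) := by
  have hw : ∀ _ : FBondY i, (0 : ℝ) < 1 := fun _ => one_pos
  have hm' : 0 < (1 - (a / m + b / Real.sqrt m + e)) * m := mul_pos (by linarith) hm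
  have hco' := deltaACubeY_coercive_of_upperDiagBound i q parS parB U₀ U' hm ha hb hco hup hθ.le
  have hpos : PosDefTr (fun _ => (1 : ℝ)) (deltaACubeY i q parS parB U') := posDefTr_of_coercive hw hm' hco'
  exact ⟨hpos, isUnit_of_posDefTr hpos, posDefTr_ringInverse hpos, fun B => trIP_ringInverse_le hw hm' hco' B,
    fun B => trIP_ringInverse_self_le hw hm' hco' B⟩

/-- ★★★ **… AND AT THE ORIGINAL `U` THROUGH A `G`-VALUED GAUGE** (`G ≦ U(N)`; the constant is an orbit invariant, `deltaACubeY_coercive_gaugeY_iff`): from (i) and a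
diagonal bound of `V(A) = Δ_{a,□}(1) − Δ_{a,□}(U^u)` with `θ < 1`: `Δ_{a,□}(U) > 0`, `IsUnit`, `G_□(U) > 0`, `(1 − θ)m⟨B, G_□(U)B⟩ ≦ ⟨B,B⟩`, `((1 − θ)m)²‖G_□(U)B‖² ≦ ‖B‖²`.
[cite: Balaban1985BackgroundPropagators, Thm 3.11 p.416, Cor. 3.6 p.408, (3.34)–(3.35) p.396, (3.86) p.407] -/
theorem GACubeY_parSymY_bounds_of_upperDiagBoundGauge (hG : G ≤ B7Prop2Explicit.unitaryUnits (Matrix (Fin N) (Fin N) ℂ))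
    {U : CfgY (Matrix (Fin N) (Fin N) ℂ) i} {u : GaugeY (Matrix (Fin N) (Fin N) ℂ) i} (hu : ∀ x, u x ∈ G) {m a b e : ℝ} (hm : 0 < m) (ha : 0 ≤ a) (hb : 0 ≤ b)
    (hco : ∀ C, m * trIP (fun _ => (1 : ℝ)) C C ≤
      trIP (fun _ => (1 : ℝ)) C (deltaACubeY i q (parSymY i) (parBY i) (fun _ _ => 1 : CfgY (Matrix (Fin N) (Fin N) ℂ) i) C))
    (hup : ∀ C, trIP (fun _ => (1 : ℝ)) C
        ((deltaACubeY i q (parSymY i) (parBY i) (fun _ _ => 1 : CfgY (Matrix (Fin N) (Fin N) ℂ) i) -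
          deltaACubeY i q (parSymY i) (parBY i) (gaugeY i u U)) C) ≤
      a * trIP (fun _ => (1 : ℝ)) C C +
        b * Real.sqrt (trIP (fun _ => (1 : ℝ)) C C) *
          Real.sqrt (trIP (fun _ => (1 : ℝ)) C (deltaACubeY i q (parSymY i) (parBY i) (fun _ _ => 1 : CfgY (Matrix (Fin N) (Fin N) ℂ) i) C)) +
        e * trIP (fun _ => (1 : ℝ)) C (deltaACubeY i q (parSymY i) (parBY i) (fun _ _ => 1 : CfgY (Matrix (Fin N) (Fin N) ℂ) i) C))
    (hθ : a / m + b / Real.sqrt m + e < 1) :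
    PosDefTr (fun _ => (1 : ℝ)) (deltaACubeY i q (parSymY i) (parBY i) U) ∧ IsUnit (deltaACubeY i q (parSymY i) (parBY i) U) ∧
      PosDefTr (fun _ => (1 : ℝ)) (GACubeY i q (parSymY i) (parBY i) U) ∧
      (∀ B : FBondY i → Matrix (Fin N) (Fin N) ℂ,
        ((1 - (a / m + b / Real.sqrt m + e)) * m) * trIP (fun _ => (1 : ℝ)) B (GACubeY i q (parSymY i) (parBY i) U B) ≤ trIP (fun _ => (1 : ℝ)) B B) ∧
      (∀ B : FBondY i → Matrix (Fin N) (Fin N) ℂ,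
        ((1 - (a / m + b / Real.sqrt m + e)) * m) ^ 2 * trIP (fun _ => (1 : ℝ)) (GACubeY i q (parSymY i) (parBY i) U B) (GACubeY i q (parSymY i) (parBY i) U B) ≤
          trIP (fun _ => (1 : ℝ)) B B) := by
  have hw : ∀ _ : FBondY i, (0 : ℝ) < 1 := fun _ => one_pos
  have hu' : ∀ x, ((u x : (Matrix (Fin N) (Fin N) ℂ)ˣ) : Matrix (Fin N) (Fin N) ℂ) ∈ unitary _ := fun x => hG (hu x)
  have hm' : 0 < (1 - (a / m + b / Real.sqrt m + e)) * m := mul_pos (by linarith) hm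
  have h1 := deltaACubeY_coercive_of_upperDiagBound i q (parSymY i) (parBY i) (fun _ _ => 1) (gaugeY i u U) hm ha hb hco hup hθ.le
  have hco' := (deltaACubeY_coercive_gaugeY_iff i q (parSymY_isGaugeLawS i) (parBY_isGaugeLawB i) hu' U).mp h1
  have hpos : PosDefTr (fun _ => (1 : ℝ)) (deltaACubeY i q (parSymY i) (parBY i) U) := posDefTr_of_coercive hw hm' hco'
  exact ⟨hpos, isUnit_of_posDefTr hpos, posDefTr_ringInverse hpos, fun B => trIP_ringInverse_le hw hm' hco' B,
    fun B => trIP_ringInverse_self_le hw hm' hco' B⟩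

end CubeLetters

/-! ## §3 The energy domination the Laplacian piece uses: `‖D₁C‖² ≦ ⟨C, Δ_{a,□}(1)C⟩` -/

section Energy

open scoped Matrix.Norms.L2Operator

variable {d ℓ : ℕ} {hd : 1 ≤ d + 1} {hL : Odd (ℓ + 1) ∧ 1 < ℓ + 1} {b₀ b₁ : ℝ} {N : ℕ}
variable (i : KIdx d ℓ hd hL b₀ b₁) (q : ↥(cubes (toKT i).D.toDomains))

/-- **`‖D₁C‖²₁ = ⟨C, Δ(1)C⟩₁ ≦ ⟨C, Δ_{a,□}(1)C⟩₁`** at def-Y's v4 transporters (`0 < b₀`): the curl square is dominated by the flat cube energy — the seminorm against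
which the Laplacian piece of `V(A)` is first order ((3.10) at a flat background, n06-j `trIP_hessY_eq_curl_of_flat`; (3.26) as forms for the cube letter, r05
`trIP_hessY_le_trIP_deltaACubeY`). [cite: Balaban1985BackgroundPropagators, (3.10) p.392, (3.26) p.395, (3.73) p.404] -/
theorem trIP_curlY_one_self_le_energy (hb₀ : 0 < b₀) (C : FBondY i → Matrix (Fin N) (Fin N) ℂ) :
    trIP (fun _ => (1 : ℝ)) (curlY i (fun _ _ => 1 : CfgY (Matrix (Fin N) (Fin N) ℂ) i) C) (curlY i (fun _ _ => 1 : CfgY (Matrix (Fin N) (Fin N) ℂ) i) C) ≤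
      trIP (fun _ => (1 : ℝ)) C (deltaACubeY i q (parSymY i) (parBY i) (fun _ _ => 1 : CfgY (Matrix (Fin N) (Fin N) ℂ) i) C) := by
  have hU : ∀ μ x, (((fun _ _ => 1 : CfgY (Matrix (Fin N) (Fin N) ℂ) i) μ x : (Matrix (Fin N) (Fin N) ℂ)ˣ) : Matrix (Fin N) (Fin N) ℂ) ∈ unitary _ :=
    fun _ _ => by simp
  have hflat : ∀ p : PlaqY i, holY i (fun _ _ => 1 : CfgY (Matrix (Fin N) (Fin N) ℂ) i) p = 1 := fun p => holY_one i p
  rw [← trIP_hessY_eq_curl_of_flat i hU hflat C]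
  exact trIP_hessY_le_trIP_deltaACubeY i q hb₀ (G := B7Prop2Explicit.unitaryUnits (Matrix (Fin N) (Fin N) ℂ)) le_rfl
    (U := (fun _ _ => 1 : CfgY (Matrix (Fin N) (Fin N) ℂ) i)) (fun _ _ => Subgroup.one_mem _) C

end Energy

end

end Literature.MathematicalPhysics.QuantumFieldTheory.Balaban1983to89.B9Thm311CubeLettersGCoerciveDiag
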